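import Summits.KontsevichZagierPeriods.Zeta5Search.WedgeDictionaryCornerIdentity
import HarnessLib

/-!
# The wedge dictionary has RANK TWO at every level (cell `pub-zeta5`, P1 — gen-1 g4's theorem, formalised)

HONEST FRAMING: systematic search; no irrationality claim unless certified.

OUR work (Summit side), P1 seat generation 3, formalising the planner seat gen-1 g4's RANK-TWO THEOREM
(`HOME/pub-zeta5-gen-1/PROOF-NOTES-g4.md` §1, §5 (a)–(e)). Fix a level `N = b₀` and write `x = t+1`, `y = x(x+N)`.

* (a) `numPoly_eq_polyNum`: pairing the Pochhammer factors `(x+s)(x+N−s) = y + s(N−s)` gives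
  `numPoly b = (2X + N)·(PiPoly b)(X(X+N))`, `PiPoly b = ∏_j ∏_{s<b_j} (X + s(N−s))` — every summand of the dual family at level `N` is
  `R_Φ(t) := (2x+N)Φ(y)/((x)_{N+1})⁶` for a polynomial `Φ = PiPoly b` in `y` (`polyNum N Φ := (2X+N)·Φ(X(X+N))`).
* (c) SUMMABLE POLYNOMIALS telescope (`pfEval_summable`): if `(2X+N)Φ(X(X+N)) = g(X+1)X⁶ − g(X)(X+N)⁶` then `R_Φ(t) = G(t+1) − G(t)` with
  `G(t) = g(x)/((x)_N)⁶` (because `(x)_{N+1} = (x)_N(x+N) = x(x+1)_N`); for `deg g < 6N` the partial fractions of `G` exist, so every order sum of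
  the data of `R_Φ` vanishes — gen-1's `𝒰_N(Φ_k) = 𝒲_N(Φ_k) = 0`, `Φ_k` from `g_k = (X(X+N−1))^k`, `k ≤ 3N−1`.
* (d) **`rank_two`**: given a DECOMPOSITION CERTIFICATE `PiPoly b = A + B·X + Σ_k λ_k Φ_k` with summable `Φ_k` (each with its `g_k`, `deg g_k < 6N`),
  `U(b) = A·U(N;0⁷) + B·U(N;1,0⁶)` and `W(b) = A·W(N;0⁷) + B·W(N;1,0⁶)` — the canonical coefficients of EVERY admissible `b` at level `N` are
  combinations of the two corner sequences (`coeffU/W (bCorner N)`, `coeffU/W (bCorner' N)`); no new telescoper per family is needed, only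
  polynomial algebra in `y` (the certificate is checked by `ring`/reflection by the user).
* (e) **`quadM3_eq_of_rank_two`**: with certificates for `b` and for its partner `b + e_j`, `U(b)W(b') − U(b')W(b) = (AB′ − BA′)·M₃(N;0⁷)`
  and `M₃(N;0⁷) = (−1)ᴺ·4·(3N)!/N!¹⁵` (`quadM3_bCorner`, PROVED) — the `Q`-part of the dictionary reduces to gen-1's zeta-free identity (QD).
-/

noncomputable section

open Finset Polynomial

namespace Summit.KontsevichZagierPeriods.Zeta5Search.WedgeDictionary

open Summit.KontsevichZagierPeriods.Zeta5Search.DualSeries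
open Literature.NumberTheory.Transcendental
open Literature.NumberTheory.Transcendental.BallRivoal (pfEval pf_unique poch_pos pochPoly eval_pochPoly pfEval_sum pfEval_sub'
  pfEval_const_mul pfEval_add)
open Literature.NumberTheory.Irrationality.CressonFischlerRivoal2008 (exists_pf_data)

/-! ### (a) `numPoly b = (2X+N)·Π_b(X(X+N))` -/

/-- `Π_b(Y) = ∏_{j=1}^{7} ∏_{s<b_j} (Y + s(b₀−s))`, a polynomial in `Y = x(x+b₀)`. -/
def PiPoly (b : ℕ → ℤ) : ℚ[X] :=
  ∏ j ∈ range 7, ∏ s ∈ range (b (j + 1)).toNat, (X + C ((s : ℚ) * ((b 0 : ℚ) - s)))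

/-- The level-`N` numerator attached to a polynomial `Φ` in `y`: `polyNum N Φ = (2X + N)·Φ(X(X+N))`. -/
def polyNum (N : ℕ) (Φ : ℚ[X]) : ℚ[X] := (C 2 * X + C (N : ℚ)) * Φ.comp (X * (X + C (N : ℚ)))

/-- `polyNum` is additive. -/
theorem polyNum_add (N : ℕ) (Φ Ψ : ℚ[X]) : polyNum N (Φ + Ψ) = polyNum N Φ + polyNum N Ψ := by
  rw [polyNum, polyNum, polyNum, add_comp, mul_add]

/-- `polyNum` is homogeneous. -/
theorem polyNum_smul (N : ℕ) (a : ℚ) (Φ : ℚ[X]) : polyNum N (C a * Φ) = C a * polyNum N Φ := by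
  rw [polyNum, polyNum, mul_comp, C_comp]; ring

/-- `polyNum` of a finite sum. -/
theorem polyNum_sum {ι : Type*} (N : ℕ) (s : Finset ι) (Φ : ι → ℚ[X]) :
    polyNum N (∑ k ∈ s, Φ k) = ∑ k ∈ s, polyNum N (Φ k) := by
  classical
  induction s using Finset.induction_on with
  | empty => simp [polyNum]
  | insert a s ha ih => rw [sum_insert ha, sum_insert ha, polyNum_add, ih]

/-- Pairing the Pochhammer factors: `(X)_m · (X + N − m + 1)_m = ∏_{s<m} (X(X+N) + s(N−s))`. -/
theorem pochPoly_pair (N : ℚ) (m : ℕ) :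
    pochPoly 0 m * pochPoly (N - m + 1) m = (∏ s ∈ range m, (X + C ((s : ℚ) * (N - s)))).comp (X * (X + C N)) := by
  have h1 : pochPoly 0 m = ∏ s ∈ range m, (X + C (s : ℚ)) := prod_congr rfl fun s _ => by rw [zero_add]
  have h2 : pochPoly (N - m + 1) m = ∏ s ∈ range m, (X + C (N - s)) := by
    unfold pochPoly
    rw [← prod_range_reflect]
    refine prod_congr rfl fun s hs => ?_
    have := mem_range.1 hs
    congr 1; congr 1
    rw [Nat.cast_sub (by omega), Nat.cast_sub (by omega)]; push_cast; ring
  rw [h1, h2, ← prod_mul_distrib, Polynomial.prod_comp]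
  refine prod_congr rfl fun s _ => ?_
  rw [add_comp, X_comp, C_comp]
  simp only [map_mul, map_sub, map_natCast]
  ring

/-- **(a)** For `b` in the box, `numPoly b = (2X + b₀)·Π_b(X(X+b₀))`. -/
theorem numPoly_eq_polyNum (b : ℕ → ℤ) (hb : InBox b) : numPoly b = polyNum (b 0).toNat (PiPoly b) := by
  obtain ⟨h0, hj⟩ := hb
  have hN : (((b 0).toNat : ℕ) : ℚ) = (b 0 : ℚ) := by exact_mod_cast Int.toNat_of_nonneg h0
  have key : ∏ j ∈ range 7, (pochPoly 0 (b (j + 1)).toNat * pochPoly ((b 0 - b (j + 1) + 1 : ℤ) : ℚ) (b (j + 1)).toNat) =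
      ∏ j ∈ range 7, (∏ s ∈ range (b (j + 1)).toNat, (X + C ((s : ℚ) * ((b 0 : ℚ) - s)))).comp (X * (X + C (b 0 : ℚ))) := by
    refine prod_congr rfl fun j hj' => ?_
    have hbj : (((b (j + 1)).toNat : ℕ) : ℚ) = (b (j + 1) : ℚ) := by exact_mod_cast Int.toNat_of_nonneg (hj j hj').1
    have hβ : ((b 0 - b (j + 1) + 1 : ℤ) : ℚ) = (b 0 : ℚ) - (((b (j + 1)).toNat : ℕ) : ℚ) + 1 := by
      rw [hbj]; push_cast; ring
    rw [hβ, pochPoly_pair]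
  rw [numPoly, polyNum, PiPoly, hN, Polynomial.prod_comp, key]

/-- The corner: `Π_{(N;0⁷)} = 1`. -/
theorem PiPoly_bCorner (N : ℕ) : PiPoly (bCorner N) = 1 := by
  unfold PiPoly
  exact prod_eq_one fun j hj => by simp [bCorner]

/-- The corner's partner: `Π_{(N;1,0⁶)} = X`. -/
theorem PiPoly_bCorner' (N : ℕ) : PiPoly (bCorner' N) = X := by
  unfold PiPoly
  rw [prod_eq_single_of_mem 0 (by simp)]
  · have e1 : bCorner' N (0 + 1) = 1 := by simp [bCorner', bCorner]
    rw [e1]; simp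
  · intro j _ hj0
    have e0 : bCorner' N (j + 1) = 0 := by rw [bCorner', Function.update_of_ne (by omega)]; simp [bCorner]
    rw [e0]; simp

/-! ### Data of `R_Φ = polyNum N Φ (x)/((x)_{N+1})⁶` -/

/-- `c` is partial-fraction data of `R_Φ(t) = (2x+N)Φ(x(x+N))/((x)_{N+1})⁶`, `x = t+1`. -/
def IsPolyData (N : ℕ) (Φ : ℚ[X]) (c : ℕ → ℕ → ℚ) : Prop :=
  ∀ t : ℚ, (∀ p, p ≤ N → t + p + 1 ≠ 0) →
    pfEval N 6 c t = ((polyNum N Φ).comp (X + C 1)).eval t / BallRivoal.poch (t + 1) (N + 1) ^ 6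

/-- For `b` in the box, data of `b` are data of `Π_b` at level `b₀`. -/
theorem isPolyData_of_isPFData {b : ℕ → ℤ} (hb : InBox b) {c : ℕ → ℕ → ℚ} (hc : IsPFData b c) :
    IsPolyData (b 0).toNat (PiPoly b) c := fun t ht => by
  rw [← numPoly_eq_polyNum b hb]; exact hc t ht

/-! ### (c) Summable polynomials telescope -/

/-- **Telescoping of a summable polynomial.** If `(2X+N)Φ(X(X+N)) = g(X+1)·X⁶ − g·(X+N)⁶` and `γ` are partial-fraction data of
`G(t) = g(t+1)/((t+1)_N)⁶` (`N ≥ 1`), then `R_Φ(t) = G(t+1) − G(t)` at every natural `t`. -/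
theorem polyNum_telescope {N : ℕ} (hN : 1 ≤ N) {Φ g : ℚ[X]}
    (hΦ : polyNum N Φ = g.comp (X + C 1) * X ^ 6 - g * (X + C (N : ℚ)) ^ 6) {γ : ℕ → ℕ → ℚ}
    (hγ : ∀ t : ℚ, (∀ p, p ≤ N - 1 → t + p + 1 ≠ 0) →
      pfEval (N - 1) 6 γ t = (g.comp (X + C 1)).eval t / BallRivoal.poch (t + 1) N ^ 6) (t : ℕ) :
    ((polyNum N Φ).comp (X + C 1)).eval (t : ℚ) / BallRivoal.poch ((t : ℚ) + 1) (N + 1) ^ 6 =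
      pfEval (N - 1) 6 γ ((t : ℚ) + 1) - pfEval (N - 1) 6 γ t := by
  rw [hγ _ (fun p _ => by positivity), hγ _ (fun p _ => by positivity), hΦ]
  simp only [eval_comp, eval_sub, eval_mul, eval_pow, eval_add, eval_X, eval_C]
  obtain ⟨M, rfl⟩ : ∃ M, N = M + 1 := ⟨N - 1, by omega⟩
  have e1 : BallRivoal.poch ((t : ℚ) + 1) (M + 1 + 1) = BallRivoal.poch ((t : ℚ) + 1) (M + 1) * ((t : ℚ) + 1 + (M + 1 : ℕ)) :=
    poch_succ_right _ _
  have e2 : BallRivoal.poch ((t : ℚ) + 1) (M + 1 + 1) = ((t : ℚ) + 1) * BallRivoal.poch ((t : ℚ) + 1 + 1) (M + 1) :=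
    poch_succ_left _ _
  have hP : BallRivoal.poch ((t : ℚ) + 1) (M + 1) ≠ 0 := (poch_pos (by positivity) _).ne'
  have hP' : BallRivoal.poch ((t : ℚ) + 1 + 1) (M + 1) ≠ 0 := (poch_pos (by positivity) _).ne'
  have ht1 : ((t : ℚ) + 1) ≠ 0 := by positivity
  have e2' : BallRivoal.poch ((t : ℚ) + 1 + 1) (M + 1) = BallRivoal.poch ((t : ℚ) + 1) (M + 1 + 1) / ((t : ℚ) + 1) := by
    rw [e2, mul_div_cancel_left₀ _ ht1]
  rw [e2', e1]
  push_cast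
  field_simp

/-- Partial fractions of `G = g(t+1)/((t+1)_N)⁶` exist when `deg g < 6N`. -/
theorem exists_pf_summable {N : ℕ} (hN : 1 ≤ N) {g : ℚ[X]} (hg : g.natDegree + 1 ≤ 6 * N) :
    ∃ γ : ℕ → ℕ → ℚ, ∀ t : ℚ, (∀ p, p ≤ N - 1 → t + p + 1 ≠ 0) →
      pfEval (N - 1) 6 γ t = (g.comp (X + C 1)).eval t / BallRivoal.poch (t + 1) N ^ 6 := by
  have hdeg : (g.comp (X + C 1)).degree < ((6 * (N - 1 + 1) : ℕ) : WithBot ℕ) := by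
    have hnat : (g.comp (X + C 1)).natDegree = g.natDegree := by rw [natDegree_comp, natDegree_X_add_C, mul_one]
    exact degree_le_natDegree.trans_lt (by rw [hnat]; exact_mod_cast (by omega))
  obtain ⟨γ, hγ⟩ := exists_pf_data (N - 1) 6 (by norm_num) _ hdeg
  exact ⟨γ, fun t ht => by rw [hγ t ht, show N - 1 + 1 = N by omega]⟩

/-! ### (d) Rank two -/

/-- **RANK TWO** (gen-1 g4, PROOF-NOTES-g4 §1). Let `b` be in the box with `Σ_j b_j ≤ 3b₀ + 1`, `N = b₀ ≥ 1`, and suppose a decomposition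
certificate `Π_b = A + B·X + Σ_{k∈s} λ_k·Φ_k` with every `Φ_k` SUMMABLE: `(2X+N)Φ_k(X(X+N)) = g_k(X+1)X⁶ − g_k(X+N)⁶`, `deg g_k < 6N`.
Then `U(b) = A·U(N;0⁷) + B·U(N;1,0⁶)` and `W(b) = A·W(N;0⁷) + B·W(N;1,0⁶)`. -/
theorem rank_two (b : ℕ → ℤ) (hb : InBox b) (hsum : ∑ j ∈ range 7, b (j + 1) ≤ 3 * b 0 + 1) (hN : 1 ≤ (b 0).toNat)
    (s : Finset ℕ) (Φ g : ℕ → ℚ[X]) (lam : ℕ → ℚ) (A B : ℚ)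
    (hΦ : ∀ k ∈ s, polyNum (b 0).toNat (Φ k) = (g k).comp (X + C 1) * X ^ 6 - g k * (X + C (((b 0).toNat : ℕ) : ℚ)) ^ 6)
    (hg : ∀ k ∈ s, (g k).natDegree + 1 ≤ 6 * (b 0).toNat)
    (hdec : PiPoly b = C A + C B * X + ∑ k ∈ s, C (lam k) * Φ k) :
    coeffU b = A * coeffU (bCorner (b 0).toNat) + B * coeffU (bCorner' (b 0).toNat) ∧
      coeffW b = A * coeffW (bCorner (b 0).toNat) + B * coeffW (bCorner' (b 0).toNat) := by
  classical
  set N := (b 0).toNat with hNdef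
  -- data
  obtain ⟨c, hc⟩ := exists_isPFData b hb hsum
  have hc0 := isPFData_corner N
  have hc1 : IsPFData (bCorner' N) (pfData (bCorner' N)) := (pfEval_corner' N 0 (fun p _ => by positivity)).1
  have hγ : ∀ k ∈ s, ∃ γ : ℕ → ℕ → ℚ, ∀ t : ℚ, (∀ p, p ≤ N - 1 → t + p + 1 ≠ 0) →
      pfEval (N - 1) 6 γ t = ((g k).comp (X + C 1)).eval t / BallRivoal.poch (t + 1) N ^ 6 :=
    fun k hk => exists_pf_summable hN (hg k hk)
  choose! γ hγ' using hγ
  -- the combined data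
  set D : ℕ → ℕ → ℚ := fun o p => ∑ k ∈ s, lam k * (shiftUp (γ k) o p - padData (N - 1) (γ k) o p) with hD
  set e : ℕ → ℕ → ℚ := fun o p => c o p - A * pfData (bCorner N) o p - B * pfData (bCorner' N) o p - D o p with he
  have hpoly0 : IsPolyData N 1 (pfData (bCorner N)) := by
    have := isPolyData_of_isPFData (inBox_bCorner N) hc0
    rwa [PiPoly_bCorner, bCorner_zero_toNat] at this
  have hpoly1 : IsPolyData N X (pfData (bCorner' N)) := by
    have := isPolyData_of_isPFData (box_bCorner' N).1 hc1
    rwa [PiPoly_bCorner', bCorner'_zero_toNat] at this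
  have hpolyb : IsPolyData N (PiPoly b) c := isPolyData_of_isPFData hb hc
  have hDeval : ∀ t : ℚ, pfEval N 6 D t =
      ∑ k ∈ s, lam k * (pfEval N 6 (shiftUp (γ k)) t - pfEval N 6 (padData (N - 1) (γ k)) t) := by
    intro t
    unfold pfEval
    simp only [hD, sum_div, mul_sum, ← sum_sub_distrib]
    simp_rw [Finset.sum_comm (s := range 6) (t := s)]
    rw [Finset.sum_comm (s := range (N + 1)) (t := s)]
    refine sum_congr rfl fun k _ => sum_congr rfl fun p _ => sum_congr rfl fun o _ => ?_
    ring
  have heval : ∀ t : ℚ, pfEval N 6 e t = pfEval N 6 c t - A * pfEval N 6 (pfData (bCorner N)) t -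
      B * pfEval N 6 (pfData (bCorner' N)) t - pfEval N 6 D t := by
    intro t
    unfold pfEval
    simp only [he, sub_div, sum_sub_distrib, mul_div_assoc, mul_sum]
  have he0 : ∀ t : ℕ, pfEval N 6 e t = 0 := by
    intro t
    have ht : ∀ p, p ≤ N → (t : ℚ) + p + 1 ≠ 0 := fun p _ => by positivity
    rw [heval, hDeval, hpolyb t ht, hpoly0 t ht, hpoly1 t ht]
    have hkk : ∀ k ∈ s, pfEval N 6 (shiftUp (γ k)) t - pfEval N 6 (padData (N - 1) (γ k)) t =
        ((polyNum N (Φ k)).comp (X + C 1)).eval (t : ℚ) / BallRivoal.poch ((t : ℚ) + 1) (N + 1) ^ 6 := by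
      intro k hk
      have e1 : pfEval N 6 (shiftUp (γ k)) t = pfEval (N - 1) 6 (γ k) ((t : ℚ) + 1) := by
        rw [show N = (N - 1) + 1 from by omega, pfEval_shiftUp, show N - 1 + 1 - 1 = N - 1 by omega]
      have e2 : pfEval N 6 (padData (N - 1) (γ k)) t = pfEval (N - 1) 6 (γ k) t := pfEval_padData (by omega) _ _ _
      rw [e1, e2]
      exact (polyNum_telescope hN (hΦ k hk) (hγ' k hk) t).symm
    rw [sum_congr rfl fun k hk => by rw [hkk k hk]]
    have hlin : polyNum N (PiPoly b) = C A * polyNum N 1 + C B * polyNum N X + ∑ k ∈ s, C (lam k) * polyNum N (Φ k) := by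
      rw [hdec, polyNum_add, polyNum_add, polyNum_sum, show C A = C A * (1 : ℚ[X]) by rw [mul_one], polyNum_smul,
        polyNum_smul, mul_one]
      congr 1
      exact sum_congr rfl fun k _ => polyNum_smul N _ _
    rw [hlin]
    simp only [eval_comp, eval_add, eval_mul, eval_C, eval_X, eval_finsetSum, add_div, sum_div, mul_div_assoc]
    ring
  have hz : ∀ {o : ℕ}, o < 6 → ∑ p ∈ range (N + 1), e o p = 0 := fun ho =>
    sum_eq_zero_of_pfEval_zero N 6 e he0 ho
  have hDsum : ∀ o : ℕ, ∑ p ∈ range (N + 1), D o p = 0 := by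
    intro o
    have htel : ∀ k ∈ s, ∑ p ∈ range (N + 1), (shiftUp (γ k) o p - padData (N - 1) (γ k) o p) = 0 := by
      intro k _
      rw [sum_sub_distrib, show N + 1 = (N - 1) + 2 by omega, sum_shiftUp, show N - 1 + 2 = (N - 1 + 1) + 1 by omega,
        sum_padData (by omega), sub_self]
    simp only [hD]
    rw [Finset.sum_comm]
    exact sum_eq_zero fun k hk => by rw [← mul_sum, htel k hk, mul_zero]
  have hexp : ∀ o : ℕ, ∑ p ∈ range (N + 1), e o p = ∑ p ∈ range (N + 1), c o p - A * ∑ p ∈ range (N + 1), pfData (bCorner N) o p -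
      B * ∑ p ∈ range (N + 1), pfData (bCorner' N) o p := by
    intro o
    simp only [he, sum_sub_distrib, ← mul_sum, hDsum o, sub_zero]
  refine ⟨?_, ?_⟩
  · have h := hz (show 4 < 6 by norm_num)
    rw [hexp] at h
    rw [coeffU_eq hc, coeffU_eq hc0, coeffU_eq hc1, bCorner_zero_toNat, bCorner'_zero_toNat, ← hNdef]
    linear_combination h
  · have h := hz (show 2 < 6 by norm_num)
    rw [hexp] at h
    rw [coeffW_eq hc, coeffW_eq hc0, coeffW_eq hc1, bCorner_zero_toNat, bCorner'_zero_toNat, ← hNdef]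
    linear_combination h

/-! ### (e) The Casoratian through the certificates -/

/-- **`M₃(b) = D·M₃(N;0⁷)`** (gen-1 g4 (C)): given rank-two certificates for `b` (`A, B`) and for a partner `b + e_{i+1}` (`A′, B′`),
`U(b)W(b+e_{i+1}) − U(b+e_{i+1})W(b) = (AB′ − BA′)·M₃(N;0⁷)`, and `M₃(N;0⁷) = (−1)ᴺ4(3N)!/N!¹⁵` (`quadM3_bCorner`). -/
theorem quadM3_eq_of_rank_two (b : ℕ → ℤ) (hb : InBox b) (hd : 0 ≤ dOf b) (hN : 1 ≤ (b 0).toNat) {i : ℕ}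
    (hi : i ∈ range 7) (hle : b (i + 1) ≤ b 0)
    (s : Finset ℕ) (Φ g : ℕ → ℚ[X]) (lam lam' : ℕ → ℚ) (A B A' B' : ℚ)
    (hΦ : ∀ k ∈ s, polyNum (b 0).toNat (Φ k) = (g k).comp (X + C 1) * X ^ 6 - g k * (X + C (((b 0).toNat : ℕ) : ℚ)) ^ 6)
    (hg : ∀ k ∈ s, (g k).natDegree + 1 ≤ 6 * (b 0).toNat)
    (hdec : PiPoly b = C A + C B * X + ∑ k ∈ s, C (lam k) * Φ k)
    (hdec' : PiPoly (Function.update b (i + 1) (b (i + 1) + 1)) = C A' + C B' * X + ∑ k ∈ s, C (lam' k) * Φ k) :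
    quadM3 b = (A * B' - B * A') * quadM3 (bCorner (b 0).toNat) := by
  obtain ⟨hb', hsum'⟩ := box_update b hb hd hi hle
  have h0 : Function.update b (i + 1) (b (i + 1) + 1) 0 = b 0 := Function.update_of_ne (by omega) _ _
  obtain ⟨hU, hW⟩ := rank_two b hb (sum_le_of_dOf b hd) hN s Φ g lam A B hΦ hg hdec
  obtain ⟨hU', hW'⟩ := rank_two _ hb' hsum' (by rw [h0]; exact hN) s Φ g lam' A' B' (by rw [h0]; exact hΦ)
    (by rw [h0]; exact hg) hdec'
  rw [h0] at hU' hW'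
  rw [← wedgeQ_eq_quadM3 b hb hd hi hle, ← cornerMinor_eq_quadM3, hU, hW, hU', hW']
  change _ = (A * B' - B * A') * (coeffU (bCorner (b 0).toNat) * coeffW (bCorner' (b 0).toNat) -
    coeffU (bCorner' (b 0).toNat) * coeffW (bCorner (b 0).toNat))
  ring

/-! ### Worked example: the edge value `M₃(N;1,0⁶) = (N⁴/3)·M₃(N;0⁷)` re-derived by rank two

(`WedgeDictionaryEdge.quadM3_bCorner'` obtained it from its own Gosper certificate; here it is polynomial algebra:
`Π_{(N;1,0⁶)} = y`, `Π_{(N;1,1,0⁵)} = y² = −N⁴/3 − (4N²/3)·y − Φ₀/(3N)` with the summable `Φ₀ = −N(3y² + 4N²y + N⁴)`, `g₀ = 1`.) -/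

/-- The first summable polynomial `Φ₀ = −N(3Y² + 4N²Y + N⁴)` (`g₀ = 1`). -/
def PhiZero (N : ℕ) : ℚ[X] := -(C (N : ℚ)) * (C 3 * X ^ 2 + C (4 * (N : ℚ) ^ 2) * X + C ((N : ℚ) ^ 4))

/-- `Φ₀` is summable: `(2X+N)Φ₀(X(X+N)) = X⁶ − (X+N)⁶`. -/
theorem polyNum_PhiZero (N : ℕ) : polyNum N (PhiZero N) = (1 : ℚ[X]).comp (X + C 1) * X ^ 6 - 1 * (X + C (N : ℚ)) ^ 6 := by
  apply Polynomial.funext; intro x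
  simp only [polyNum, PhiZero, eval_mul, eval_add, eval_sub, eval_neg, eval_comp, eval_pow, eval_C, eval_X, eval_one]
  ring

/-- `Π_{(N;1,1,0⁵)} = X²`. -/
theorem PiPoly_bEdge (N : ℕ) : PiPoly (Function.update (bCorner' N) (1 + 1) (bCorner' N (1 + 1) + 1)) = X ^ 2 := by
  unfold PiPoly
  rw [Function.update_of_ne (by norm_num)]
  have hval : ∀ j ∈ range 7, (Function.update (bCorner' N) (1 + 1) (bCorner' N (1 + 1) + 1) (j + 1)).toNat =
      if j = 0 ∨ j = 1 then 1 else 0 := by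
    intro j _
    by_cases hj0 : j = 0
    · subst hj0; rw [Function.update_of_ne (by norm_num)]; simp [bCorner', bCorner]
    by_cases hj1 : j = 1
    · subst hj1; simp [bCorner', bCorner]
    · rw [Function.update_of_ne (by omega), bCorner', Function.update_of_ne (by omega)]; simp [bCorner, hj0, hj1]
  rw [prod_congr rfl fun j hj => by rw [hval j hj], bCorner'_zero]
  simp [prod_range_succ]
  ring

/-- **The edge value by rank two**: `M₃(N;1,0⁶) = (N⁴/3)·M₃(N;0⁷)` for `N ≥ 1` (cf. `quadM3_bCorner'`). -/
theorem quadM3_bCorner'_by_rank_two (N : ℕ) (hN : 1 ≤ N) :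
    quadM3 (bCorner' N) = ((N : ℚ) ^ 4 / 3) * quadM3 (bCorner N) := by
  have hb := (box_bCorner' N).1
  have hd : 0 ≤ dOf (bCorner' N) := by
    unfold dOf; rw [bCorner'_zero]
    have : ∑ j ∈ range 7, bCorner' N (j + 1) = 1 := by
      rw [show (1 : ℤ) = ∑ j ∈ range 7, if j = 0 then (1 : ℤ) else 0 by simp]
      refine sum_congr rfl fun j _ => ?_
      by_cases hj0 : j = 0
      · subst hj0; simp [bCorner', bCorner]
      · rw [bCorner', Function.update_of_ne (by omega)]; simp [bCorner, hj0]
    rw [this]; omega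
  have hN0 : (bCorner' N 0).toNat = N := bCorner'_zero_toNat N
  have hNq : (N : ℚ) ≠ 0 := by exact_mod_cast (show N ≠ 0 by omega)
  have key := quadM3_eq_of_rank_two (bCorner' N) hb hd (by rw [hN0]; exact hN) (i := 1) (by simp)
    (by rw [bCorner'_zero, bCorner', Function.update_of_ne (by norm_num)]; simp [bCorner])
    {0} (fun _ => PhiZero N) (fun _ => 1) (fun _ => 0) (fun _ => -1 / (3 * (N : ℚ))) 0 1 (-(N : ℚ) ^ 4 / 3)
    (-(4 * (N : ℚ) ^ 2 / 3))
    (fun k _ => by rw [hN0]; exact polyNum_PhiZero N) (fun k _ => by rw [hN0]; simp; omega)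
    (by rw [PiPoly_bCorner']; simp)
    (by
      rw [PiPoly_bEdge, sum_singleton, PhiZero]
      apply Polynomial.funext; intro x
      simp only [eval_add, eval_mul, eval_C, eval_X, eval_pow, eval_neg, neg_mul]
      field_simp
      ring)
  rw [key, hN0]
  ring

end Summit.KontsevichZagierPeriods.Zeta5Search.WedgeDictionary
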